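import Literature.IUT.LogThetaLattice.GlobalKummerNonInterference
import Literature.IUT.LogThetaLattice.GlobalKummerNonInterferenceProofs
import Literature.IUT.LogThetaLattice.GlobalKummerNonInterferenceCompatibleFamilies
import Mathlib.Algebra.Group.Units.Equiv
import HarnessLib

/-!
# [IUTchIII] Proposition 3.10 (iii) from (i) — the Frobenioid-theoretic log-Kummer correspondence
# (proof-only companion №2 of `GlobalKummerNonInterference.lean`; DAG node **IUTchIII:Prop3.10(iii)**)

Proof-only companion (abc-iut cell, D-0067 discharge wave 4, DISCHARGE-L6 v1.5 §F-a row **F5**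
«Prop 3.10 (i) ⇒ (iii)»; seat abc-iut-w4-d002) of the FROZEN statement file
`Literature/IUT/LogThetaLattice/GlobalKummerNonInterference.lean` (abc-iut-L6-t4, v4 = p407875; companions
p405475 `…Proofs`, p408636 `…CompatibleFamilies`). S. Mochizuki, *Inter-universal Teichmüller theory III*,
kurims manuscript (May 2020) of PRIMS **57** (2021), §3, Proposition 3.10 pp. 147–149, Remark 3.10.1 (i)
pp. 149–150 (claim key Mochizuki2012, DISPUTED, D-0012). NO new definitions; nothing here takes a side on
[IUTchIII] Cor. 3.12; typed ≠ discharged elsewhere.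

PRINTED CLAIM (Prop. 3.10 (iii), p. 149 l. 16): "The relevant Kummer isomorphisms of (i) induce, via the
'log-Kummer correspondence' of (ii) [cf. also Proposition 3.7, (i); Remarks 3.6.1, 3.9.2], isomorphisms of
Frobenioids `(^{n,m}𝓕⊛_MOD)_α ⥲ 𝓕⊛_MOD(^{n,∘}𝓗𝓣^{𝒟-Θ^{±ell}NF})_α`, `(^{n,m}𝓕⊛ℝ_MOD)_α ⥲ 𝓕⊛ℝ_MOD(^{n,∘}𝓗𝓣^{𝒟-Θ^{±ell}NF})_α`
that are mutually compatible, as `m` varies over the elements of `ℤ`, with the log-links"; second display: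
the same for the "associated `𝓕^{⊩⊥}`-prime-strips `^{n,m}𝔉^{⊩⊥}_LGP ⥲ 𝔉^{⊩⊥}(^{n,∘}𝓗𝓣^{𝒟-Θ^{±ell}NF})_LGP`".
PRINTED MECHANISM (Rmk. 3.10.1 (i), pp. 149–150): "the log-Kummer correspondence of Proposition 3.10, (ii),
induces isomorphisms of Frobenioids as in the first display of Proposition 3.10, (iii), precisely because
the construction of '`(†𝓕⊛_MOD)_α`' only involves the group '`(†𝕄⊛_MOD)_α`', together with the collection of
subquotients of its perfection indexed by `𝕍` [cf. Proposition 3.7, (i); Remarks 3.6.1, 3.9.2]."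
PRINTED PROOF (p. 149): "follow immediately from the definitions and the references quoted".

WHAT IS PROVED HERE, against the typed predicate `Prop310iii_compatible F kum lg`
(`∀ m x, kum (m+1) (lg m x) = kum m x`; kernel-DAG name `Summit.ABC.IUTFork.DAG.N_IUTchIII_Prop3_10_iii`):

* `Prop310iii_compatible_iff_lg_eq_kummerComposite` — the typed (iii) holds IF AND ONLY IF every log-link-
  induced map between consecutive Frobenius-like copies IS the composite of Kummer identifications through
  the vertically coric copy, `lg m = (kum (m+1))⁻¹ ∘ kum m` (the "log-Kummer correspondence" route of (ii):
  the `m`-th and `(m+1)`-th copies are related THROUGH their common Kummer image, "not via a single Kummer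
  isomorphism", p. 148); hence such `lg` is UNIQUE (`Prop310iii_compatible.lg_unique`) and the Kummer
  composite always satisfies (iii) (`Prop310iii_compatible_kummerComposite`).
* `Prop310iii_compatible_of_functorialAlgorithm` — the MECHANISM of Rmk. 3.10.1 (i) as a kernel theorem:
  ANY functorial algorithm `Φ` (NAMED hypothesis standing for [IUTchIII] Prop. 3.7 (i) / Ex. 3.6 (i) /
  Rmk. 3.6.1: "`𝓕⊛_MOD` is constructed from the [number] field `𝕄⊛_MOD` alone") transports the column of
  Kummer isomorphisms of FIELDS `κ_m : (^{n,m}𝕄⊛_MOD)_j ⥲ 𝕄⊛_MOD(^{n,∘})_j` of Prop. 3.10 (i) to object-level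
  isomorphisms `Φ(κ_m)` that ARE compatible with the log-link-induced maps `Φ(κ_{m+1}⁻¹ ∘ κ_m)` — by
  functoriality alone; a multiplicative-group version `…_of_functorialAlgorithm_units` (for "monoids").
* `VerticallyCoricGlobalData.prop310iii_frobenioids` / `…_strips` — the two displays of (iii) for the
  OUTPUT SIGNATURE `VerticallyCoricGlobalData` of Prop. 3.10 (i) (its fields `kummerField`, `kummerFMOD`,
  `kummerSLGP`): given an object functor `onOb` for the abstract Frobenioid isomorphism type `IsoF` (resp.
  `onObS` for `IsoS`) and the Prop-3.7-(i) functorial-algorithm slot, the Kummer isomorphisms of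
  Frobenioids / `𝓕^{⊩⊥}`-strips are log-link compatible, the log-link-induced maps being the Kummer
  composites (the only possible choice, by the first bullet).
* `Prop310ii_logKummer'_of_kummerTransport` — the translation-invariance clause of the corrected typing of
  (ii) (`Prop310ii_logKummer'`, v3 of the statement file) HOLDS for the actions of the groups
  `(^{n,m}𝕄⊛_MOD)_j^×` on any coric module obtained by transport along the Kummer isomorphisms of (i), for
  EVERY relation `Rel` under which related elements have the same Kummer image (the typer's docstring asks
  that `Rel` be instantiated by abc-iut-L6-t3's log-link relation — that instantiation is NOT done here;
  this lemma isolates what it must satisfy).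
* `Remark3101ii_contrast_MOD_of_kummer` — consequently the `MOD`/LGP conjunct of the v4 contrast
  `Remark3101ii_contrast` (existence of a compatible family on the `MOD` side) is inhabited by the Kummer
  data of (i) with the Kummer-composite log-link maps.

HONEST SCOPE. The Frobenioids `𝓕⊛_MOD(K)` as a REAL functor of the number field `K` (Prop. 3.7 (i)
construction clauses = DISCHARGE-L6 row F10, abc-iut-L6-t4 g2 `ThetaPilotObjectsReal`) are NOT constructed
here: the functorial algorithm enters BY NAME as the hypotheses `ΦK`/`ΦL`/`hΦ` (resp. `onOb`, `hK`). What the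
kernel certifies is exactly the inference "(i) + functoriality of the `𝓕⊛_MOD`-construction in `𝕄⊛_MOD` ⇒
(iii)", together with the converse bookkeeping that (iii) admits no other log-link-induced maps. The
non-interference identity of (ii) (roots of unity) is p405475's `Prop310ii_nonInterference_places` and is
not re-proved. [claim: Mochizuki2012, status: disputed] for every quoted sentence; the mathematics below is
elementary transport of bijections.
-/

namespace Literature.IUT.LogThetaLattice

universe u v w

/-! ### (iii) characterised: the log-link-induced maps are the Kummer composites -/

section Characterisation

variable {C : Type u} {F : ℤ → Type u}

/-- **IUTchIII:Prop3.10(iii)** (p. 149 l. 16) CHARACTERISED at the typed level: a family of Kummer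
identifications `kum m : F m ≃ C` of the Frobenius-like copies with the vertically coric copy is "mutually
compatible, as `m` varies over the elements of `ℤ`, with the log-links" (`Prop310iii_compatible F kum lg`)
IF AND ONLY IF each log-link-induced map `lg m : F m → F (m+1)` is the composite
`(kum (m+1))⁻¹ ∘ kum m` of Kummer identifications through the coric copy — the route "via the log-Kummer
correspondence of (ii)" (p. 149; Rmk. 3.10.1 (i)). (The forward implication refines
`lg_bijective_of_compatible` of the statement file.) [claim: Mochizuki2012, status: disputed] -/
theorem Prop310iii_compatible_iff_lg_eq_kummerComposite (kum : ∀ m, F m ≃ C)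
    (lg : ∀ m, F m → F (m + 1)) :
    Literature.IUT.LogThetaLattice.Prop310iii_compatible F kum lg ↔
      ∀ m, lg m = ⇑((kum m).trans (kum (m + 1)).symm) := by
  constructor
  · intro h m
    funext x
    apply (kum (m + 1)).injective
    rw [h m x, Equiv.trans_apply, Equiv.apply_symm_apply]
  · intro h m x
    rw [h m, Equiv.trans_apply, Equiv.apply_symm_apply]

/-- **IUTchIII:Prop3.10(iii)**, existence half (p. 149 l. 16; Rmk. 3.10.1 (i)): with the log-link-induced
maps DEFINED as the Kummer composites through the vertically coric copy ("via the log-Kummer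
correspondence of (ii)"), every family of Kummer identifications is log-link compatible — PROVED.
[claim: Mochizuki2012, status: disputed] -/
theorem Prop310iii_compatible_kummerComposite (kum : ∀ m, F m ≃ C) :
    Literature.IUT.LogThetaLattice.Prop310iii_compatible F kum
      (fun m => ⇑((kum m).trans (kum (m + 1)).symm)) :=
  (Prop310iii_compatible_iff_lg_eq_kummerComposite kum _).mpr fun _ => rfl

/-- **IUTchIII:Prop3.10(iii)**, uniqueness half: for a given column of Kummer identifications there is AT
MOST ONE family of log-link-induced maps compatible with it (so the `MOD`/LGP column is "rigid", Fig. 3.2,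
Rmk. 3.10.1 (iv)) — PROVED. [claim: Mochizuki2012, status: disputed] -/
theorem Prop310iii_compatible.lg_unique {kum : ∀ m, F m ≃ C} {lg lg' : ∀ m, F m → F (m + 1)}
    (h : Literature.IUT.LogThetaLattice.Prop310iii_compatible F kum lg)
    (h' : Literature.IUT.LogThetaLattice.Prop310iii_compatible F kum lg') : lg = lg' := by
  funext m
  rw [(Prop310iii_compatible_iff_lg_eq_kummerComposite kum lg).mp h m,
    (Prop310iii_compatible_iff_lg_eq_kummerComposite kum lg').mp h' m]

end Characterisation

/-! ### Rmk. 3.10.1 (i) as a kernel theorem: a functorial algorithm transports Kummer columns -/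

section Functorial

variable {K : ℤ → Type u} [∀ m, Field (K m)] {Kc : Type u} [Field Kc]

/-- **[IUTchIII] Rmk. 3.10.1 (i) (pp. 149–150) / Prop. 3.10 (iii) first display (p. 149)** — the
MECHANISM, PROVED: let `κ m : K m ≃+* Kc` be the Kummer isomorphisms of FIELDS
`(^{n,m}𝕄⊛_MOD)_j ⥲ 𝕄⊛_MOD(^{n,∘}𝓗𝓣^𝒟)_j` of Prop. 3.10 (i), and let `Φ` be a FUNCTORIAL ALGORITHM producing from a
field an object type (`Ob m` from `K m`, `Obc` from `Kc` — e.g. the objects of `𝓕⊛_MOD`, Prop. 3.7 (i) /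
Ex. 3.6 (i), whose construction "only involves the group `(†𝕄⊛_MOD)_α` together with the collection of
subquotients of its perfection indexed by `𝕍`", themselves "completely determined by the ring structure of
the field", Rmk. 3.6.1) and from field isomorphisms bijections of objects (`ΦK` on the Kummer arrows, `ΦL`
on the consecutive-copy arrows), functorially (`hΦ`). Then the induced Kummer isomorphisms of objects
`Φ(κ_m)` are MUTUALLY COMPATIBLE WITH THE LOG-LINKS, the log-link-induced map `(n,m) → (n,m+1)` on objects
being `Φ` of the log-Kummer identification `κ_{m+1}⁻¹ ∘ κ_m` of the two Frobenius-like copies of the number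
field through the coric copy (Prop. 3.10 (ii)). The algorithm is a NAMED HYPOTHESIS (Prop. 3.7 (i) slot),
not constructed here. [claim: Mochizuki2012, status: disputed] -/
theorem Prop310iii_compatible_of_functorialAlgorithm (κ : ∀ m, K m ≃+* Kc)
    (Ob : ℤ → Type v) (Obc : Type v)
    (ΦK : ∀ m, (K m ≃+* Kc) → (Ob m ≃ Obc))
    (ΦL : ∀ m, (K m ≃+* K (m + 1)) → (Ob m ≃ Ob (m + 1)))
    (hΦ : ∀ m (σ : K m ≃+* K (m + 1)) (τ : K (m + 1) ≃+* Kc),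
      ΦK m (σ.trans τ) = (ΦL m σ).trans (ΦK (m + 1) τ)) :
    Literature.IUT.LogThetaLattice.Prop310iii_compatible Ob (fun m => ΦK m (κ m))
      (fun m => ⇑(ΦL m ((κ m).trans (κ (m + 1)).symm))) := by
  intro m x
  have hs : ((κ m).trans (κ (m + 1)).symm).trans (κ (m + 1)) = κ m :=
    RingEquiv.ext fun y => by simp
  have h := hΦ m ((κ m).trans (κ (m + 1)).symm) (κ (m + 1))
  rw [hs] at h
  show ΦK (m + 1) (κ (m + 1)) (ΦL m ((κ m).trans (κ (m + 1)).symm) x) = ΦK m (κ m) x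
  rw [h, Equiv.trans_apply]

/-- Conversely, under the same functoriality the log-link-induced object maps of ANY compatible family with
Kummer part `Φ(κ_m)` coincide with `Φ(κ_{m+1}⁻¹ ∘ κ_m)` — the Frobenioid-theoretic log-Kummer correspondence is
DETERMINED by the field-theoretic one (Rmk. 3.10.1 (ii) "precise log-Kummer correspondence, rigid",
Fig. 3.2) — PROVED. [claim: Mochizuki2012, status: disputed] -/
theorem Prop310iii_compatible.lg_eq_functorialAlgorithm (κ : ∀ m, K m ≃+* Kc)
    (Ob : ℤ → Type v) (Obc : Type v)
    (ΦK : ∀ m, (K m ≃+* Kc) → (Ob m ≃ Obc))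
    (ΦL : ∀ m, (K m ≃+* K (m + 1)) → (Ob m ≃ Ob (m + 1)))
    (hΦ : ∀ m (σ : K m ≃+* K (m + 1)) (τ : K (m + 1) ≃+* Kc),
      ΦK m (σ.trans τ) = (ΦL m σ).trans (ΦK (m + 1) τ))
    {lg : ∀ m, Ob m → Ob (m + 1)}
    (h : Literature.IUT.LogThetaLattice.Prop310iii_compatible Ob (fun m => ΦK m (κ m)) lg) (m : ℤ) :
    lg m = ⇑(ΦL m ((κ m).trans (κ (m + 1)).symm)) :=
  congrFun (h.lg_unique (Prop310iii_compatible_of_functorialAlgorithm κ Ob Obc ΦK ΦL hΦ)) m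

end Functorial

section FunctorialUnits

variable {M : ℤ → Type u} [∀ m, Group (M m)] {Mc : Type u} [Group Mc]

/-- The same mechanism at the level of GROUPS / monoids (Prop. 3.10 (i): "Kummer isomorphisms of fields,
monoids, Frobenioids" — the groups `(^{n,m}𝕄⊛_MOD)_j` of nonzero elements; Rmk. 3.10.1 (i): "`(†𝓕⊛_MOD)_α` only
involves the group `(†𝕄⊛_MOD)_α`"): a functorial algorithm from groups to object types transports a column of
Kummer isomorphisms of groups `κ m : M m ≃* Mc` into a log-link-compatible family, with the log-link-induced
maps `Φ(κ_{m+1}⁻¹ ∘ κ_m)` — PROVED. [claim: Mochizuki2012, status: disputed] -/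
theorem Prop310iii_compatible_of_functorialAlgorithm_units (κ : ∀ m, M m ≃* Mc)
    (Ob : ℤ → Type v) (Obc : Type v)
    (ΦK : ∀ m, (M m ≃* Mc) → (Ob m ≃ Obc))
    (ΦL : ∀ m, (M m ≃* M (m + 1)) → (Ob m ≃ Ob (m + 1)))
    (hΦ : ∀ m (σ : M m ≃* M (m + 1)) (τ : M (m + 1) ≃* Mc),
      ΦK m (σ.trans τ) = (ΦL m σ).trans (ΦK (m + 1) τ)) :
    Literature.IUT.LogThetaLattice.Prop310iii_compatible Ob (fun m => ΦK m (κ m))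
      (fun m => ⇑(ΦL m ((κ m).trans (κ (m + 1)).symm))) := by
  intro m x
  have hs : ((κ m).trans (κ (m + 1)).symm).trans (κ (m + 1)) = κ m :=
    MulEquiv.ext fun y => by simp
  have h := hΦ m ((κ m).trans (κ (m + 1)).symm) (κ (m + 1))
  rw [hs] at h
  show ΦK (m + 1) (κ (m + 1)) (ΦL m ((κ m).trans (κ (m + 1)).symm) x) = ΦK m (κ m) x
  rw [h, Equiv.trans_apply]

end FunctorialUnits

/-! ### The two displays of (iii) for the output signature of Prop. 3.10 (i) -/

section FromVerticallyCoricData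

variable {lstar : ℕ} {Frd : Type u} {IsoF : Frd → Frd → Type w} {Strip : Type u}
  {IsoS : Strip → Strip → Type w}

/-- **IUTchIII:Prop3.10(iii), first display** (p. 149 l. 16–22), for the OUTPUT SIGNATURE of Prop. 3.10
(i) (`VerticallyCoricGlobalData`, fields `kummerField` = "Kummer isomorphisms of fields
`(^{n,m}𝕄⊛_mod)_j ⥲ 𝕄⊛_mod(^{n,∘}𝓗𝓣^𝒟)_j`", `kummerFMOD` = "Kummer isomorphisms of Frobenioids
`(^{n,m}𝓕⊛_MOD)_j ⥲ 𝓕⊛_MOD(^{n,∘}𝓗𝓣^𝒟)_j`") at a label `j ∈ 𝔽_l^⋇`: given the action `onOb` of Frobenioid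
isomorphisms (type `IsoF`) on objects ([FrdI] — abstract here), the functorial algorithm of Prop. 3.7 (i)
on the log-Kummer field identifications (`ΦL`, `ΦK`, `hΦ` — NAMED slot) and the compatibility of (i)
("Kummer isomorphisms of fields, monoids, Frobenioids … compatible with the various … natural
isomorphisms", p. 148: the Frobenioid Kummer isomorphism acts on objects as the one induced from the field
Kummer isomorphism, `hK`), the Kummer isomorphisms of Frobenioids ARE "mutually compatible, as `m` varies
over the elements of `ℤ`, with the log-links" — the log-link-induced object maps being those induced by the
log-Kummer identifications `κ_{m+1}⁻¹ ∘ κ_m` (Rmk. 3.10.1 (i)) — PROVED. The same statement read with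
`onOb` := objects of the REALIFICATION gives the `𝓕⊛ℝ_MOD` clause. [claim: Mochizuki2012, status: disputed] -/
theorem VerticallyCoricGlobalData.prop310iii_frobenioids
    (D : VerticallyCoricGlobalData lstar Frd IsoF Strip IsoS) (j : Fin lstar)
    (Ob : Frd → Type v) (onOb : ∀ {A B : Frd}, IsoF A B → (Ob A ≃ Ob B))
    (ΦK : ∀ m, letI := D.instFieldFrob; letI := D.instField
      (D.Mfrob m j ≃+* D.Mcoric j) → (Ob (D.FMODfrob m j) ≃ Ob (D.FMOD j)))
    (ΦL : ∀ m, letI := D.instFieldFrob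
      (D.Mfrob m j ≃+* D.Mfrob (m + 1) j) → (Ob (D.FMODfrob m j) ≃ Ob (D.FMODfrob (m + 1) j)))
    (hΦ : ∀ m, letI := D.instFieldFrob; letI := D.instField
      ∀ (σ : D.Mfrob m j ≃+* D.Mfrob (m + 1) j) (τ : D.Mfrob (m + 1) j ≃+* D.Mcoric j),
        ΦK m (σ.trans τ) = (ΦL m σ).trans (ΦK (m + 1) τ))
    (hK : ∀ m, onOb (D.kummerFMOD m j) = ΦK m (D.kummerField m j)) :
    letI := D.instFieldFrob; letI := D.instField
    Literature.IUT.LogThetaLattice.Prop310iii_compatible (fun m => Ob (D.FMODfrob m j))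
      (fun m => onOb (D.kummerFMOD m j))
      (fun m => ⇑(ΦL m ((D.kummerField m j).trans (D.kummerField (m + 1) j).symm))) := by
  letI := D.instFieldFrob; letI := D.instField
  have h := Prop310iii_compatible_of_functorialAlgorithm (K := fun m => D.Mfrob m j)
    (fun m => D.kummerField m j) (fun m => Ob (D.FMODfrob m j)) (Ob (D.FMOD j)) ΦK ΦL hΦ
  intro m x
  show onOb (D.kummerFMOD (m + 1) j) (ΦL m ((D.kummerField m j).trans (D.kummerField (m + 1) j).symm) x)
    = onOb (D.kummerFMOD m j) x
  rw [hK (m + 1), hK m]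
  exact h m x

/-- **IUTchIII:Prop3.10(iii), first display — rigidity**: for the data of Prop. 3.10 (i) as above, ANY
family of log-link-induced object maps compatible with the Kummer isomorphisms of Frobenioids coincides with
the one induced by the log-Kummer field identifications ("precise log-Kummer correspondence", Rmk. 3.10.1
(ii)/(iv), Fig. 3.2) — PROVED. [claim: Mochizuki2012, status: disputed] -/
theorem VerticallyCoricGlobalData.prop310iii_frobenioids_lg_eq
    (D : VerticallyCoricGlobalData lstar Frd IsoF Strip IsoS) (j : Fin lstar)
    (Ob : Frd → Type v) (onOb : ∀ {A B : Frd}, IsoF A B → (Ob A ≃ Ob B))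
    (ΦK : ∀ m, letI := D.instFieldFrob; letI := D.instField
      (D.Mfrob m j ≃+* D.Mcoric j) → (Ob (D.FMODfrob m j) ≃ Ob (D.FMOD j)))
    (ΦL : ∀ m, letI := D.instFieldFrob
      (D.Mfrob m j ≃+* D.Mfrob (m + 1) j) → (Ob (D.FMODfrob m j) ≃ Ob (D.FMODfrob (m + 1) j)))
    (hΦ : ∀ m, letI := D.instFieldFrob; letI := D.instField
      ∀ (σ : D.Mfrob m j ≃+* D.Mfrob (m + 1) j) (τ : D.Mfrob (m + 1) j ≃+* D.Mcoric j),
        ΦK m (σ.trans τ) = (ΦL m σ).trans (ΦK (m + 1) τ))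
    (hK : ∀ m, onOb (D.kummerFMOD m j) = ΦK m (D.kummerField m j))
    {lg : ∀ m, Ob (D.FMODfrob m j) → Ob (D.FMODfrob (m + 1) j)}
    (h : Literature.IUT.LogThetaLattice.Prop310iii_compatible (fun m => Ob (D.FMODfrob m j))
      (fun m => onOb (D.kummerFMOD m j)) lg) (m : ℤ) :
    letI := D.instFieldFrob; letI := D.instField
    lg m = ⇑(ΦL m ((D.kummerField m j).trans (D.kummerField (m + 1) j).symm)) :=
  congrFun (h.lg_unique (D.prop310iii_frobenioids j Ob onOb ΦK ΦL hΦ hK)) m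

/-- **IUTchIII:Prop3.10(iii), second display** (p. 149 l. 23–30), for the OUTPUT SIGNATURE of Prop.
3.10 (i) (fields `SLGPfrob m` = `^{n,m}𝔉^⊩_LGP`, `SLGP` = `𝔉^⊩(^{n,∘}𝓗𝓣^𝒟)_LGP`, `kummerSLGP m` = their Kummer
isomorphisms): given the action `onObS` of strip isomorphisms (type `IsoS`) on the underlying data of the
associated `𝓕^{⊩⊥}`-prime-strips ([IUTchIII] Def. 2.4 (iii) — abstract here), the induced isomorphisms
`^{n,m}𝔉^{⊩⊥}_LGP ⥲ 𝔉^{⊩⊥}(^{n,∘}𝓗𝓣^𝒟)_LGP` "are mutually compatible, as `m` varies over the elements of `ℤ`, with the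
log-links", the log-link-induced maps being the Kummer composites through the coric strip (the route "via
the global log-Kummer correspondence of (ii) and the splitting monoid portion of the log-Kummer
correspondence of Proposition 3.5, (ii)"), and these are the ONLY compatible log-link-induced maps —
PROVED (both clauses). [claim: Mochizuki2012, status: disputed] -/
theorem VerticallyCoricGlobalData.prop310iii_strips
    (D : VerticallyCoricGlobalData lstar Frd IsoF Strip IsoS)
    (ObS : Strip → Type v) (onObS : ∀ {X Y : Strip}, IsoS X Y → (ObS X ≃ ObS Y)) :
    Literature.IUT.LogThetaLattice.Prop310iii_compatible (fun m => ObS (D.SLGPfrob m))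
        (fun m => onObS (D.kummerSLGP m))
        (fun m => ⇑((onObS (D.kummerSLGP m)).trans (onObS (D.kummerSLGP (m + 1))).symm)) ∧
      ∀ lg : ∀ m, ObS (D.SLGPfrob m) → ObS (D.SLGPfrob (m + 1)),
        Literature.IUT.LogThetaLattice.Prop310iii_compatible (fun m => ObS (D.SLGPfrob m))
            (fun m => onObS (D.kummerSLGP m)) lg →
          ∀ m, lg m = ⇑((onObS (D.kummerSLGP m)).trans (onObS (D.kummerSLGP (m + 1))).symm) :=
  ⟨Prop310iii_compatible_kummerComposite _,
    fun lg h => (Prop310iii_compatible_iff_lg_eq_kummerComposite _ lg).mp h⟩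

end FromVerticallyCoricData

/-! ### (ii), corrected typing: translation invariance for Kummer-transported actions -/

section LogKummerTransport

variable {K : ℤ → Type u} [∀ m, Field (K m)] {Kc : Type u} [Field Kc]

/-- **IUTchIII:Prop3.10(ii), second paragraph** (pp. 148–149), corrected per-index typing
`Prop310ii_logKummer'` of the statement file (v3): let the groups `(^{n,m}𝕄⊛_MOD)_j^× = (K m)ˣ` of nonzero
elements act on a coric module `X` THROUGH the Kummer isomorphisms `κ m` of Prop. 3.10 (i) and one action
`ρ` of the coric group `(Kc)ˣ` (the "pre-composites of Kummer isomorphisms" route, p. 148). Then for EVERY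
relation `Rel m` between the `m`-th and `(m+1)`-th copies under which related elements have the SAME Kummer
image in the coric copy, the typed statement HOLDS: every copy has the same image in `Aut(X)` ("invariant
with respect to the translation symmetries … of the `n`-th column", p. 149; PROVED from the surjectivity of
the Kummer isomorphisms) and related elements act identically (definitional for such `Rel`). The typer's
docstring requires `Rel` := THE log-link relation of [IUTchIII] Def. 1.1 / Prop. 1.2 (abc-iut-L6-t3,
TODO-merge); this lemma records exactly what that instantiation has to verify (`hRel`), it does not perform
it. [claim: Mochizuki2012, status: disputed] -/
theorem Prop310ii_logKummer'_of_kummerTransport (κ : ∀ m, K m ≃+* Kc) {X : Type u}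
    (ρ : Kcˣ →* Equiv.Perm X) (Rel : ∀ m, (K m)ˣ → (K (m + 1))ˣ → Prop)
    (hRel : ∀ m (g : (K m)ˣ) (g' : (K (m + 1))ˣ), Rel m g g' →
      Units.mapEquiv (κ (m + 1)).toMulEquiv g' = Units.mapEquiv (κ m).toMulEquiv g) :
    Literature.IUT.LogThetaLattice.Prop310ii_logKummer' (fun m => (K m)ˣ)
      (fun m => ρ.comp (Units.mapEquiv (κ m).toMulEquiv).toMonoidHom) Rel := by
  refine ⟨fun m => ?_, fun m g g' hg => ?_⟩
  · have hr : ∀ n, Set.range ⇑(ρ.comp (Units.mapEquiv (κ n).toMulEquiv).toMonoidHom) = Set.range ρ :=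
      fun n => by
        rw [MonoidHom.coe_comp]
        exact (Units.mapEquiv (κ n).toMulEquiv).surjective.range_comp ρ
    rw [hr m, hr (m + 1)]
  · simp only [MonoidHom.coe_comp, Function.comp_apply, MulEquiv.coe_toMonoidHom]
    rw [hRel m g g' hg]

end LogKummerTransport

/-! ### Rmk. 3.10.1 (ii), v4 contrast: the `MOD` conjunct is inhabited by the Kummer data of (i) -/

section Contrast

variable {CMOD Cfrak : Type u} {FMOD Ffrak : ℤ → Type u}

/-- [IUTchIII] Rmk. 3.10.1 (ii) (p. 150), v4 "contentful reading" `Remark3101ii_contrast`: its FIRST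
conjunct — "on the `MOD`/LGP side a log-link-compatible family of Kummer identifications EXISTS (Prop.
3.10 (iii))" — is WITNESSED by any column of Kummer identifications `kum` with the Kummer-composite
log-link maps; so the contrast reduces to its `𝔪𝔬𝔡`-side conjunct `Remark3101i_noCompatibleIso` — PROVED
(definitional bookkeeping). [claim: Mochizuki2012, status: disputed] -/
theorem Remark3101ii_contrast_MOD_of_kummer (kum : ∀ m, FMOD m ≃ CMOD)
    (lgfrak : ∀ m, Ffrak m → Ffrak (m + 1))
    (hfrak : Literature.IUT.LogThetaLattice.Remark3101i_noCompatibleIso (C := Cfrak) Ffrak lgfrak) :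
    Literature.IUT.LogThetaLattice.Remark3101ii_contrast CMOD Cfrak FMOD Ffrak
      (fun m => ⇑((kum m).trans (kum (m + 1)).symm)) lgfrak :=
  ⟨⟨kum, Prop310iii_compatible_kummerComposite kum⟩, hfrak⟩

end Contrast

end Literature.IUT.LogThetaLattice
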